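import Summits.SmoothPoincare4.SmoothPoincare4.Theorems.ConvexBisectionAcyclicBisectionExistsBeltPageTubeGlue
import Summits.SmoothPoincare4.SmoothPoincare4.Theorems.ConvexBisectionAcyclicBisectionExistsSeamTwistSignWind
import HarnessLib

/-!
# Hgap ▸ part B (page twisting of the straightened dual framed knot), brick G2-1 (tube side, III):
# the page twisting of the attaching framing is the winding number of the first column `A e₀`
(wave 6, crux stmt-SmoothPoincare4-10508, line `modp-braid-orbits`, stub `stub_T3_dualPresentation` (T3)
▸ node `Hgap` ▸ part B `helper_Hgap_twisting`; registered sub-goal `helper_pageTwisting_eq_wind_frameCol`)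

The column datum of the winding count `helper_wind_beltCount` (`…HgapTwistWind.lean`): for an attaching map
`f` of a 2-handle on `Base g` with attaching circle `K` in the flat page of direction `c` and Z4's page tube
`Φ` around `K` (fibre frame `∂_v|₀ Φ (e^{2πit}, v) = v₀ r iK' + v₁ κ rot`), the PAGE TWISTING of the handle
framing is the winding number of the loop of first columns `A(x) e₀ = frameCol f♭ Φ x` of the transition
matrix (`pageTwisting_eq_wind_frameCol`, registered `helper_pageTwisting_eq_wind_frameCol`): by Y1's
`exists_ambient_attachingFraming_eq` the handle framing read in `ℝ⁴` is `c₀ K' + a₀ r iK' + a₁ κ rot`,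
`a = A e₀`, so the twisting loop is `(a₀ r‖K'‖² + a₁ κ⟪rot, iK'⟫, a₁ κ ⟪rot, n⟫)` — an upper-triangular
positive-diagonal image of `toC ∘ a` (`pageTwistingLoop_attachingFraming_plain`), with the same winding
number (X3 `wind_upperTriangular`).  (Y1's `pageTwisting_eq_int_add_wind` is the same statement for the
TWISTED tube `twistTube Φ σ`, `σ = ±1`; the plain tube is what the rows `helper_beltRows_pageTube` use.)
So for a Lefschetz link, `wind (t ↦ toC (A (e^{2πit}) e₀)) = t_j`.

Everything is proved; no named facts, no `sorry`.  References: A. A. Kosinski, *Differential Manifolds*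
(1993), III (3.1) [Kosinski1993]; R. E. Gompf, A. I. Stipsicz, *4-Manifolds and Kirby Calculus* (1999), §4.5
[GompfStipsicz1999].
-/

noncomputable section

set_option linter.dupNamespace false

open scoped Manifold ContDiff Topology
open Set Function Metric Filter Complex

namespace Summit.SmoothPoincare4.SmoothPoincare4.Theorems.AcyclicBisectionExists.ModpBraidOrbits

open Literature.Topology.FourManifolds Literature.Topology.FourManifolds.LefschetzBase
  Literature.Topology.FourManifolds.HandleAttachingMap Literature.Geometry.Symplectic
  Literature.Topology.PlaneTopology

variable {g : ℕ} {c : ℂ} (f : HandleAttachingMap 3 2 (Base g)) (hc : ‖c‖ = 1)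
  (hKc : ∀ θ, f.attachingCircle θ ∈ page g c) {κ r : ℝ} (hκ : 0 < κ) (hr : 0 < r)
  {Φ : CircleTube (bBase g).carrier} (hΦcore : ∀ ψ, (bBase g).incl (Φ.core ψ) = f.attachingCircle ψ)
  (hΦder : ∀ t : ℝ, HasFDerivAt (fun v : EuclideanSpace ℝ (Fin 2) =>
      ((bBase g).incl (Φ.toHomeo (circlePt t, v))).1)
    ((EuclideanSpace.proj (𝕜 := ℝ) (0 : Fin 2)).smulRight (r • cplxJ (deriv (ambCurve g f.attachingCircle) t)) +
      (EuclideanSpace.proj (𝕜 := ℝ) (1 : Fin 2)).smulRight (κ • rotField g (f.attachingCircle (circlePt t)).1)) 0)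

include hΦcore in
/-- The boundary tube of `f` and the page tube `Φ` have the same core. [folklore] -/
theorem boundaryTube_core_eq_pageTube (θ : sphere (0 : EuclideanSpace ℝ (Fin 2)) 1) :
    f.boundaryTube.core θ = Φ.core θ :=
  Subtype.ext ((HandleAttachingMap.coe_boundaryTube_core f θ).trans (hΦcore θ).symm)

include hKc hΦcore hΦder in
/-- **The twisting loop of the handle framing, read through the (untwisted) page tube**: with
`a = A(x) e₀ = frameCol f♭ Φ x`, `x = e^{2πit}`,
`pageTwistingLoop (t) = (a₀ · r ‖K'‖² + a₁ · κ ⟪rot, iK'⟫, a₁ · κ ⟪rot, n⟫)`. [cite: Kosinski1993, III (3.1)] -/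
theorem pageTwistingLoop_attachingFraming_plain (t : ℝ) :
    pageTwistingLoop g f.attachingCircle f.attachingFraming t =
      ⟨CircleTube.frameCol f.boundaryTube Φ (circlePt t) 0 * (r * ‖deriv (ambCurve g f.attachingCircle) t‖ ^ 2) +
        CircleTube.frameCol f.boundaryTube Φ (circlePt t) 1 *
          (κ * inner ℝ (rotField g (f.attachingCircle (circlePt t)).1) (cplxJ (deriv (ambCurve g f.attachingCircle) t))),
       CircleTube.frameCol f.boundaryTube Φ (circlePt t) 1 *
          (κ * inner ℝ (rotField g (f.attachingCircle (circlePt t)).1) (horizNormal g (ambCurve g f.attachingCircle t)))⟩ := by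
  have hcore := boundaryTube_core_eq_pageTube f hΦcore
  obtain ⟨c₀, hc₀⟩ := exists_ambient_attachingFraming_eq f hcore t (hΦder t)
  obtain ⟨hKn, hiKn⟩ := inner_velocity_horizNormal_eq_zero f hKc t
  set a : EuclideanSpace ℝ (Fin 2) := CircleTube.frameCol f.boundaryTube Φ (circlePt t) with ha_def
  have hLa : ((EuclideanSpace.proj (𝕜 := ℝ) (0 : Fin 2)).smulRight (r • cplxJ (deriv (ambCurve g f.attachingCircle) t)) +
      (EuclideanSpace.proj (𝕜 := ℝ) (1 : Fin 2)).smulRight (κ • rotField g (f.attachingCircle (circlePt t)).1)) a =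
      a 0 • (r • cplxJ (deriv (ambCurve g f.attachingCircle) t)) +
        a 1 • (κ • rotField g (f.attachingCircle (circlePt t)).1) := by
    simp [ContinuousLinearMap.smulRight_apply, ha_def]
  have hν : ambient g (f.attachingCircle (circlePt t)) (f.attachingFraming (circlePt t)) =
      c₀ • deriv (ambCurve g f.attachingCircle) t +
        (a 0 • (r • cplxJ (deriv (ambCurve g f.attachingCircle) t)) +
          a 1 • (κ • rotField g (f.attachingCircle (circlePt t)).1)) :=
    hc₀.trans (congrArg (fun v : EuclideanSpace ℝ (Fin 4) => c₀ • deriv (ambCurve g f.attachingCircle) t + v) hLa)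
  apply Complex.ext
  · show inner ℝ (ambient g (f.attachingCircle (circlePt t)) (f.attachingFraming (circlePt t)))
      (cplxJ (deriv (ambCurve g f.attachingCircle) t)) =
      a 0 * (r * ‖deriv (ambCurve g f.attachingCircle) t‖ ^ 2) +
        a 1 * (κ * inner ℝ (rotField g (f.attachingCircle (circlePt t)).1) (cplxJ (deriv (ambCurve g f.attachingCircle) t)))
    rw [hν, inner_add_left, inner_add_left, real_inner_smul_left, real_inner_smul_left, real_inner_smul_left,
      real_inner_smul_left, real_inner_smul_left, inner_cplxJ_self, inner_cplxJ_cplxJ]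
    ring
  · show inner ℝ (ambient g (f.attachingCircle (circlePt t)) (f.attachingFraming (circlePt t)))
      (horizNormal g (ambCurve g f.attachingCircle t)) =
      a 1 * (κ * inner ℝ (rotField g (f.attachingCircle (circlePt t)).1) (horizNormal g (ambCurve g f.attachingCircle t)))
    rw [hν, inner_add_left, inner_add_left, real_inner_smul_left, real_inner_smul_left, real_inner_smul_left,
      real_inner_smul_left, real_inner_smul_left, hKn, hiKn]
    ring

include hc hKc hκ hr hΦcore hΦder in
/-- **The page twisting of the handle framing is the winding number of the first column `A e₀`** (brick
G2-1, tube side III): `pageTwisting g K ν_f = wind (t ↦ toC (frameCol f♭ Φ (e^{2πit})))` — the twisting loop is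
the upper-triangular positive-diagonal image `(α a₀ + β a₁, γ a₁)` of `toC ∘ a` (`α = r‖K'‖² > 0`,
`γ = κ ⟪rot, n⟫ > 0`), and such images have the same winding number (`wind_upperTriangular`).
[cite: GompfStipsicz1999, §4.5] -/
theorem pageTwisting_eq_wind_frameCol :
    pageTwisting g f.attachingCircle f.attachingFraming =
      wind (fun t => toC (CircleTube.frameCol f.boundaryTube Φ (circlePt t))) := by
  have hcore := boundaryTube_core_eq_pageTube f hΦcore
  have hK := isSmoothEmbedding_attachingCircle f
  -- the ingredients, as functions of `t`
  set F : ℝ → EuclideanSpace ℝ (Fin 2) := fun t => CircleTube.frameCol f.boundaryTube Φ (circlePt t) with hF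
  set T : ℝ → EuclideanSpace ℝ (Fin 4) := fun t => deriv (ambCurve g f.attachingCircle) t with hT
  set ρ : ℝ → EuclideanSpace ℝ (Fin 4) := fun t => rotField g (f.attachingCircle (circlePt t)).1 with hρ
  set n : ℝ → EuclideanSpace ℝ (Fin 4) := fun t => horizNormal g (ambCurve g f.attachingCircle t) with hn
  set α : ℝ → ℝ := fun t => r * ‖T t‖ ^ 2 with hα
  set βc : ℝ → ℝ := fun t => κ * inner ℝ (ρ t) (cplxJ (T t)) with hβ
  set γ : ℝ → ℝ := fun t => κ * inner ℝ (ρ t) (n t) with hγ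
  -- positivity and non-vanishing
  have hFne : ∀ t, F t ≠ 0 := fun t => CircleTube.frameCol_ne_zero hcore _
  have hTne : ∀ t, T t ≠ 0 := fun t h0 => by
    have hKd : MDifferentiableAt (𝓡 1) (𝓡∂ 4) f.attachingCircle (circlePt t) := hK.contMDiff.mdifferentiableAt (by simp)
    have h1 : deriv (ambCurve g f.attachingCircle) t = 0 := h0
    rw [deriv_ambCurve hKd] at h1
    exact knotVelocity_ne_zero hK t (injective_ambient _ (h1.trans (map_zero _).symm))
  have hαpos : ∀ t, 0 < α t := fun t => mul_pos hr (by positivity [norm_pos_iff.2 (hTne t)])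
  have hγpos : ∀ t, 0 < γ t := fun t => mul_pos hκ (inner_rotField_horizNormal_pos f hc hKc t)
  -- continuity
  have hK1 : ContMDiff (𝓡 1) (𝓡∂ 4) 1 f.attachingCircle := hK.contMDiff.of_le (by simp)
  have hTc : Continuous T := (contDiff_ambCurve hK1).continuous_deriv le_rfl
  have hKc' : Continuous fun t : ℝ => f.attachingCircle (circlePt t) := hK.contMDiff.continuous.comp continuous_circlePt
  have hρc : Continuous ρ := (contDiff_rotField g).continuous.comp (continuous_subtype_val.comp hKc')
  have hnc : Continuous n := continuous_horizNormal_coe.comp hKc'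
  have hFc : Continuous F := (CircleTube.contMDiff_frameCol hcore).continuous.comp continuous_circlePt
  have hαc : Continuous α := continuous_const.mul ((continuous_norm.comp hTc).pow 2)
  have hβc' : Continuous βc := continuous_const.mul (hρc.inner (continuous_cplxJ.comp hTc))
  have hγc : Continuous γ := continuous_const.mul (hρc.inner hnc)
  -- periodicity
  have hd1 : deriv (ambCurve g f.attachingCircle) 1 = deriv (ambCurve g f.attachingCircle) 0 := by
    have := deriv_ambCurve_add_one (g := g) (L := f.attachingCircle) 0
    rwa [zero_add] at this
  have ham : ambCurve g f.attachingCircle 1 = ambCurve g f.attachingCircle 0 := by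
    have := ambCurve_add_one (g := g) (L := f.attachingCircle) 0
    rwa [zero_add] at this
  -- the loop `toC ∘ a` is a non-vanishing loop
  have hℓ : IsNonvanishingLoop fun t => toC (F t) := by
    refine ⟨(contDiff_toC.continuous.comp hFc).continuousOn, fun t _ h0 => ?_, ?_⟩
    · have h1 : ‖F t‖ = 0 := by rw [← norm_toC, h0, norm_zero]
      exact hFne t (norm_eq_zero.1 h1)
    show toC (F 0) = toC (F 1)
    simp only [hF, circlePt_one_eq_zero]
  -- the twisting loop is the upper-triangular image of `toC ∘ a`
  have hloop : pageTwistingLoop g f.attachingCircle f.attachingFraming =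
      fun t => (⟨α t * (toC (F t)).re + βc t * (toC (F t)).im, γ t * (toC (F t)).im⟩ : ℂ) := by
    funext t
    rw [pageTwistingLoop_attachingFraming_plain f hKc hΦcore hΦder t, toC_re, toC_im]
    apply Complex.ext
    · show F t 0 * (r * ‖T t‖ ^ 2) + F t 1 * (κ * inner ℝ (ρ t) (cplxJ (T t))) = α t * F t 0 + βc t * F t 1
      simp only [hα, hβ]; ring
    · show F t 1 * (κ * inner ℝ (ρ t) (n t)) = γ t * F t 1
      simp only [hγ]; ring
  rw [pageTwisting, hloop]
  have key := wind_upperTriangular hℓ hαc.continuousOn hβc'.continuousOn hγc.continuousOn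
    (by simp only [hα, hT, hd1]) (by simp only [hβ, hρ, hT, hd1, circlePt_one_eq_zero])
    (by simp only [hγ, hρ, hn, ham, circlePt_one_eq_zero]) (Or.inl rfl)
    (fun t _ => by rw [Int.cast_one, one_mul]; exact hαpos t) (fun t _ => hγpos t)
  rw [key, one_mul]

/-- **Sub-goal `helper_pageTwisting_eq_wind_frameCol` of stub `stub_T3_dualPresentation`** (T3 ▸ node `Hgap` ▸ part B
`helper_Hgap_twisting`, brick G2-1 tube side III; wave 6, lead c5): the page twisting of the handle framing equals
the winding number of the first columns `A(e^{2πit}) e₀` of the transition matrix against Z4's page tube.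
[cite: GompfStipsicz1999, §4.5] -/
theorem helper_pageTwisting_eq_wind_frameCol : ∀ (g : ℕ) (c : ℂ) (f : Literature.Topology.FourManifolds.HandleAttachingMap 3 2 (Literature.Topology.FourManifolds.LefschetzBase.Base g)), ‖c‖ = 1 → (∀ θ, f.attachingCircle θ ∈ Literature.Topology.FourManifolds.LefschetzBase.page g c) → ∀ (κ r : ℝ), 0 < κ → 0 < r → ∀ (Φ : Literature.Topology.FourManifolds.CircleTube (Literature.Topology.FourManifolds.LefschetzBase.bBase g).carrier), (∀ ψ, (Literature.Topology.FourManifolds.LefschetzBase.bBase g).incl (Φ.core ψ) = f.attachingCircle ψ) → (∀ t : ℝ, HasFDerivAt (fun v : EuclideanSpace ℝ (Fin 2) => ((Literature.Topology.FourManifolds.LefschetzBase.bBase g).incl (Φ.toHomeo (Literature.Topology.FourManifolds.circlePt t, v))).1) ((EuclideanSpace.proj (𝕜 := ℝ) (0 : Fin 2)).smulRight (r • Literature.Topology.FourManifolds.LefschetzBase.cplxJ (deriv (Literature.Topology.FourManifolds.LefschetzBase.ambCurve g f.attachingCircle) t)) + (EuclideanSpace.proj (𝕜 := ℝ) (1 :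 Fin 2)).smulRight (κ • Summit.SmoothPoincare4.SmoothPoincare4.Theorems.AcyclicBisectionExists.ModpBraidOrbits.rotField g (f.attachingCircle (Literature.Topology.FourManifolds.circlePt t)).1)) 0) → Literature.Topology.FourManifolds.LefschetzBase.pageTwisting g f.attachingCircle f.attachingFraming = Literature.Topology.PlaneTopology.wind (fun t => Literature.Topology.FourManifolds.toC (Literature.Topology.FourManifolds.CircleTube.frameCol f.boundaryTube Φ (Literature.Topology.FourManifolds.circlePt t))) :=
  fun _ _ f hc hKc _ _ hκ hr _ hΦcore hΦder => pageTwisting_eq_wind_frameCol f hc hKc hκ hr hΦcore hΦder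

end Summit.SmoothPoincare4.SmoothPoincare4.Theorems.AcyclicBisectionExists.ModpBraidOrbits

end
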